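import Literature.AlgebraicGeometry.Frobenioids.RealificationMapInjectiveCountableSuppWeak
import Literature.AlgebraicGeometry.Frobenioids.MonoidFunctorsOnD
import Literature.AnabelianGeometry.EtaleTheta.RealifiedDivisorMonoidsOfRlfWeak
import HarnessLib

/-!
# [EtTh] Def 3.6 (i): the binder `hBinj` at the CONSTRUCTED WEAK-vocabulary data `ofRlfRWeak` (`Λ = ℝ`,
# `B₀^ℝ := ℝ·Φ₀^birat`) — REDUCED to Φ₀-level laws (injective pull-backs, disjoint supports of pulled-back distinct
# primes, countable supports), one morphism at a time

S. Mochizuki, *The étale theta function …*, Publ. RIMS **45** (2009) [MochizukiEtTh2009], Def 3.1 (i)–(iii) PDF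
pp.70–72 (divisor monoids of tempered Frobenioids, contravariant by PULL-BACK), Def 3.3 (iii) p.73, Def 3.6 (i) p.76
(`B₀^Λ := ℝ·Φ₀^birat ⊆ (Φ₀^ℝ)^gp` for `Λ = ℝ`) [cite: MochizukiEtTh2009, Def 3.6 p.76]; S. Mochizuki, *The geometry of
Frobenioids I* (2008), Def 2.4 (i) p.48, Prop 5.3 p.103 [cite: MochizukiFrdI2008, Prop. 5.3 p.103].

abc-iut cell, seat abc-iut-w5-d153 (gen 4).  PROOF-ONLY (0 defs).  Weak-vocabulary twin of this seat's
`Discharge/Sec3BLambdaInjectiveOfRlfR.lean` (strong data `ofRlfR`): the genuine Def 3.3 (iii) record of the cell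
(abc-iut-w6-d058's `DivisorMonoids.ofGaloisAction`) is weakly perf-factorial only (`prop34_i_phiZero`, F-L2d2-1), so its
`Λ = ℝ` realified data is abc-iut-L2-d2's `RealifiedDivisorMonoids.ofRlfRWeak dm hpf` (`hpf : IsPerfFactorialCof`), whose
pull-backs of `B₀^ℝ = ℝ·Φ₀^birat` are restrictions of `(Φ₀(g)^rlf)^gp` with `Φ₀(g)^rlf = rlfMapWeak`.  For ONE morphism `g`:
* `coe_ofRlfRWeak_BΛ_map` — on underlying elements, `B₀^ℝ(g) = gpMap (rlfMapWeak g)`;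
* `ofRlfRWeak_BΛ_map_injective_of_rlfMapWeak_injective` — injective pull-back ⟸ `rlfMapWeak g` injective (no `B₀` input);
* **`ofRlfRWeak_BΛ_map_injective_of_disjoint_supp_of_countable`** / `…_of_countable_primes` — ⟸ (a) `Φ₀(g)` injective,
  (b) primary elements of distinct primes of `Φ₀(Y)^pf` pull back to elements of `Φ₀(Y')^rlf` with disjoint supports,
  (c) countable supports (resp. countably many primes) — by this seat's
  `IsPerfFactorialWeak.Rlf.injective_of_disjoint_supp_of_countable` (`RealificationMapInjectiveCountableSuppWeak.lean`);
and the universally quantified forms `ofRlfRWeak_hBinj_of_…`.  At the genuine record (a) is abc-iut-w6-d058's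
`ofGaloisActionConnected_Φ₀_map_injective`; (b), (c) are print's pull-back geometry of Def 3.1 (distinct prime divisors
have disjoint preimages; countably many components and cusps, GAP-LEDGER G-L2d2-4) — GAP-LEDGER G-w5d179-1 (Λ = ℝ reading).
HONEST FRAMING: a reduction between explicit hypotheses; refereed pre-IUT material; nothing here bears on [IUTchIII] Cor. 3.12.
-/

namespace Literature.AnabelianGeometry.EtaleTheta

open CategoryTheory Opposite Function Literature.AlgebraicGeometry.Frobenioids

universe u v w

namespace RealifiedDivisorMonoids

variable {D₀ : Type u} [Category.{v} D₀] (dm : DivisorMonoids.{u, v, w} D₀)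
  (hpf : ∀ Y : D₀ᵒᵖ, IsPerfFactorialCof (dm.Φ₀.obj Y))

/-- `rlfMapWeak` lies over `Φ₀(g)^pf`, elementwise. [cite: MochizukiFrdI2008, Prop. 5.3 p.103] -/
theorem rlfMapWeak_toRealification_apply {Y Y' : D₀ᵒᵖ} (g : Y ⟶ Y') (a : Perfection (dm.Φ₀.obj Y)) :
    rlfMapWeak dm.Φ₀ hpf g ((hpf Y).weak.toRealification a) =
      (hpf Y').weak.toRealification (Perfection.map (dm.Φ₀.map g).hom a) := by
  have h := DFunLike.congr_fun (rlfMapWeak_comp_toRealification dm.Φ₀ hpf g) a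
  rwa [MonoidHom.comp_apply, MonoidHom.comp_apply] at h

/-- The pull-back of `B₀^ℝ = ℝ·Φ₀^birat` along `g` at `ofRlfRWeak dm hpf` is, on underlying elements of `(Φ₀^rlf(Y))^gp`,
the groupification of the weak realified pull-back `rlfMapWeak g`. [cite: MochizukiEtTh2009, Def 3.6 p.76] -/
theorem coe_ofRlfRWeak_BΛ_map {Y Y' : D₀ᵒᵖ} (g : Y ⟶ Y') (c : (ofRlfRWeak dm hpf).BΛ.obj Y) :
    (show ↥(((realDataWeak dm hpf).realSpan dm.biratGp).carrier (unop Y')) from ((ofRlfRWeak dm hpf).BΛ.map g).hom c).1 =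
      gpMap (rlfMapWeak dm.Φ₀ hpf g)
        (show ↥(((realDataWeak dm hpf).realSpan dm.biratGp).carrier (unop Y)) from c).1 := by
  change pullGp (rlfFunctorWeak dm.Φ₀ hpf) g.unop _ = _
  rw [pullGp, ← gpMap_eq_monGpMap]
  rfl

/-- **Per-morphism form**: the pull-back of `B₀^ℝ` along ONE `g` at `ofRlfRWeak` is injective as soon as `rlfMapWeak g`
is (the realifications are cancellative, so groupification preserves injectivity).  No `B₀`-level input.
[cite: MochizukiEtTh2009, Def 3.6 p.76] -/
theorem ofRlfRWeak_BΛ_map_injective_of_rlfMapWeak_injective {Y Y' : D₀ᵒᵖ} (g : Y ⟶ Y')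
    (hrlf : Injective (rlfMapWeak dm.Φ₀ hpf g)) : Injective ((ofRlfRWeak dm hpf).BΛ.map g).hom := by
  intro c c' h
  haveI := IsPerfFactorialWeak.Rlf.isCancelMul (hpf Y).weak
  haveI := IsPerfFactorialWeak.Rlf.isCancelMul (hpf Y').weak
  have h1 : gpMap (rlfMapWeak dm.Φ₀ hpf g)
        (show ↥(((realDataWeak dm hpf).realSpan dm.biratGp).carrier (unop Y)) from c).1 =
      gpMap (rlfMapWeak dm.Φ₀ hpf g)
        (show ↥(((realDataWeak dm hpf).realSpan dm.biratGp).carrier (unop Y)) from c').1 := by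
    rw [← coe_ofRlfRWeak_BΛ_map, ← coe_ofRlfRWeak_BΛ_map, h]
  exact Subtype.ext (gpMap_injective _ hrlf h1)

/-- **Per-morphism form from Φ₀-LEVEL laws (weak vocabulary)**: along ONE morphism `g`, the pull-back of `B₀^ℝ` at
`ofRlfRWeak` is injective provided (a) `Φ₀(g)` is injective, (b) primary elements of distinct primes of `Φ₀(Y)^pf` pull
back along `g` to elements with disjoint supports in `Φ₀(Y')^rlf`, (c) every element of `Φ₀(Y)^pf` has countable support.
[cite: MochizukiEtTh2009, Def 3.6 p.76] -/
theorem ofRlfRWeak_BΛ_map_injective_of_disjoint_supp_of_countable {Y Y' : D₀ᵒᵖ} (g : Y ⟶ Y')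
    (hinj : Injective (dm.Φ₀.map g).hom)
    (hdisj : ∀ (𝔭 𝔮 : Primes (Perfection (dm.Φ₀.obj Y))), 𝔭 ≠ 𝔮 → ∀ x ∈ 𝔭.carrier, ∀ y ∈ 𝔮.carrier,
      Disjoint (supp ((hpf Y').weak.toRealification (Perfection.map (dm.Φ₀.map g).hom x) : RlfFactor (dm.Φ₀.obj Y')))
        (supp ((hpf Y').weak.toRealification (Perfection.map (dm.Φ₀.map g).hom y) : RlfFactor (dm.Φ₀.obj Y'))))
    (hcnt : ∀ a : Perfection (dm.Φ₀.obj Y), (supp (factorMap (dm.Φ₀.obj Y) a)).Countable) :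
    Injective ((ofRlfRWeak dm hpf).BΛ.map g).hom :=
  ofRlfRWeak_BΛ_map_injective_of_rlfMapWeak_injective dm hpf g
    (IsPerfFactorialWeak.Rlf.injective_of_disjoint_supp_of_countable (hpf Y).weak (hpf Y').weak
      (rlfMapWeak dm.Φ₀ hpf g) (rlfMapWeak_toRealification_apply dm hpf g) hinj hdisj hcnt)

/-- The same with (c) replaced by countability of `Prime(Φ₀(Y)^pf)`. [cite: MochizukiEtTh2009, Def 3.6 p.76] -/
theorem ofRlfRWeak_BΛ_map_injective_of_disjoint_supp_of_countable_primes {Y Y' : D₀ᵒᵖ} (g : Y ⟶ Y')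
    (hinj : Injective (dm.Φ₀.map g).hom)
    (hdisj : ∀ (𝔭 𝔮 : Primes (Perfection (dm.Φ₀.obj Y))), 𝔭 ≠ 𝔮 → ∀ x ∈ 𝔭.carrier, ∀ y ∈ 𝔮.carrier,
      Disjoint (supp ((hpf Y').weak.toRealification (Perfection.map (dm.Φ₀.map g).hom x) : RlfFactor (dm.Φ₀.obj Y')))
        (supp ((hpf Y').weak.toRealification (Perfection.map (dm.Φ₀.map g).hom y) : RlfFactor (dm.Φ₀.obj Y'))))
    (hcnt : Countable (Primes (Perfection (dm.Φ₀.obj Y)))) :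
    Injective ((ofRlfRWeak dm hpf).BΛ.map g).hom :=
  ofRlfRWeak_BΛ_map_injective_of_disjoint_supp_of_countable dm hpf g hinj hdisj fun _ => Set.to_countable _

/-- **`hBinj` at `ofRlfRWeak dm hpf` from Φ₀-LEVEL laws** (universally quantified form of the above).
[cite: MochizukiEtTh2009, Def 3.6 p.76] -/
theorem ofRlfRWeak_hBinj_of_disjoint_supp_of_countable
    (hinj : ∀ {Y Y' : D₀ᵒᵖ} (g : Y ⟶ Y'), Injective (dm.Φ₀.map g).hom)
    (hdisj : ∀ {Y Y' : D₀ᵒᵖ} (g : Y ⟶ Y') (𝔭 𝔮 : Primes (Perfection (dm.Φ₀.obj Y))), 𝔭 ≠ 𝔮 →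
      ∀ x ∈ 𝔭.carrier, ∀ y ∈ 𝔮.carrier,
        Disjoint (supp ((hpf Y').weak.toRealification (Perfection.map (dm.Φ₀.map g).hom x) : RlfFactor (dm.Φ₀.obj Y')))
          (supp ((hpf Y').weak.toRealification (Perfection.map (dm.Φ₀.map g).hom y) : RlfFactor (dm.Φ₀.obj Y'))))
    (hcnt : ∀ (Y : D₀ᵒᵖ) (a : Perfection (dm.Φ₀.obj Y)), (supp (factorMap (dm.Φ₀.obj Y) a)).Countable) :
    ∀ {Y Y' : D₀ᵒᵖ} (g : Y ⟶ Y'), Injective ((ofRlfRWeak dm hpf).BΛ.map g).hom :=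
  fun g => ofRlfRWeak_BΛ_map_injective_of_disjoint_supp_of_countable dm hpf g (hinj g) (hdisj g) (hcnt _)

/-- The same with countably many primes at every object. [cite: MochizukiEtTh2009, Def 3.6 p.76] -/
theorem ofRlfRWeak_hBinj_of_disjoint_supp_of_countable_primes
    (hinj : ∀ {Y Y' : D₀ᵒᵖ} (g : Y ⟶ Y'), Injective (dm.Φ₀.map g).hom)
    (hdisj : ∀ {Y Y' : D₀ᵒᵖ} (g : Y ⟶ Y') (𝔭 𝔮 : Primes (Perfection (dm.Φ₀.obj Y))), 𝔭 ≠ 𝔮 →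
      ∀ x ∈ 𝔭.carrier, ∀ y ∈ 𝔮.carrier,
        Disjoint (supp ((hpf Y').weak.toRealification (Perfection.map (dm.Φ₀.map g).hom x) : RlfFactor (dm.Φ₀.obj Y')))
          (supp ((hpf Y').weak.toRealification (Perfection.map (dm.Φ₀.map g).hom y) : RlfFactor (dm.Φ₀.obj Y'))))
    (hcnt : ∀ Y : D₀ᵒᵖ, Countable (Primes (Perfection (dm.Φ₀.obj Y)))) :
    ∀ {Y Y' : D₀ᵒᵖ} (g : Y ⟶ Y'), Injective ((ofRlfRWeak dm hpf).BΛ.map g).hom :=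
  fun g => ofRlfRWeak_BΛ_map_injective_of_disjoint_supp_of_countable_primes dm hpf g (hinj g) (hdisj g) (hcnt _)

end RealifiedDivisorMonoids

end Literature.AnabelianGeometry.EtaleTheta
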